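import Literature.AlgebraicGeometry.AbelianSchemes.WeilDualityHermitianOfPolarization   -- ★ (W-λ) H1 `exists_hermitianDuality_of_polarization`
import Literature.AlgebraicGeometry.GroupSchemes.CartierDualBlockDuality                 -- ★ `exists_blockDuality`
import Literature.AlgebraicGeometry.GroupSchemes.TorsionLayerBlockIdempotents            -- ★ layer-endomorphism calculus, `exists_fixedLayer`
import Literature.AlgebraicGeometry.GroupSchemes.ConnectedFactorsThroughUnitComponent     -- ★ `isMonHom_of_comp`
import Literature.NumberTheory.Automorphic.GaloisActionPlaces                              -- ★ `g • w` on `HeightOneSpectrum` (ED. 2 §0)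
import Mathlib.NumberTheory.NumberField.CMField
import HarnessLib

/-!
# The two-block cut of the hermitian Weil duality: `A[𝔭_w𝔭_{c•w}] ≅ A[𝔭_w𝔭_{c•w}]^D` with its pair of adjoint block idempotents
# ([Mumford AV] §20 (I) p. 189; [Tate 1997] §(3.8); [Tate 1967] §2.2)

Topic `Literature/AlgebraicGeometry/AbelianSchemes`; namespace `Literature.AlgebraicGeometry.AbelianSchemes.AbelianSchemeOver.DualPair`.  THEOREMS ONLY
(no definition, no named fact, no instance, no notation, no `sorry`).  Cell `hodgecm-mathlib` (D-0151), F0∕P6 «MOD», line L2 (socket `stub_DOWN`), organ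
(ρ2′) brick **(W-λ) H2 «TWO-BLOCK CUT»** (LA2-plan (g0) RULING «ρ-ROAD v2.1» 06:01:31Z; LA2-p04 (g0) 06:26:52Z token list = the INPUT of ★ (BLK)
`IsotropicSubgroupEqOfBlockEq`): from the hermitian Weil duality `e₀ : A[p] ≅ A[p]^D` of ★ (W-λ) H1 (any field `k`, any prime `p`) and a pair of
CRT elements `e_w, e_{c•w}` of the coefficient ring (idempotent and orthogonal MODULO `p`, `e_w + e_{c•w} ≡ 1` modulo the two-block ideal `I = 𝔭_w𝔭_{c•w}`,
swapped by `star` modulo `p`), CUT OUT the realisation `G′ = A[I] ↪ A[p]` (the fixed layer of the self-adjoint idempotent `β(e_w + e_{c•w})`), its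
perfect duality `e : G′ ≅ G′^D` (★ `exists_blockDuality`) and the two layer idempotents `εW = β(e_w)|_{G′}`, `εV = β(e_{c•w})|_{G′}` with
`εW · εV = 𝟙` (pointwise), `εV ≫ εV = εV`, `εW ≫ εW = εW`, and the Rosati adjointness `εW ≫ e = e ≫ εV^D`.  `--supports stmt-HodgeConjecture-24832`,
count-neutral.  HC_CM is proved only modulo the printed citations (2 remaining named inputs hLiu418 24832, h413 24833) until rung 0 closes; nothing here is about HC.

## Mathematics

`G = A[p]` with its layer endomorphisms `β : 𝒪 → End G` (additive, anti-multiplicative, unital; `[p]_G = 1`); `ε := β(e_w + e_{c•w})` is an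
idempotent homomorphism (`(e_w+e_{c•w})² ≡ e_w+e_{c•w} (p)`), SELF-ADJOINT for `e₀` (hermitian `β(a†) ≫ e₀ = e₀ ≫ β(a)^D` at `a = e_w + e_{c•w}`,
`(e_w + e_{c•w})† ≡ e_w + e_{c•w} (p)`); `G′ := Fix ε` realises `A[I]` (`I·(e_w+e_{c•w}) ⊆ (p)`, `e_w + e_{c•w} − 1 ∈ I`, `p ∈ I`); ★ block duality
gives `e := ι ≫ e₀ ≫ ι^D : G′ ≅ G′^D`; `β(e_w)`, `β(e_{c•w})` commute with `ε` and restrict to `εW`, `εV` on `G′`; `εW·εV = β(e_w+e_{c•w})|_{G′} = 𝟙`,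
`εV² = εV` (`e_{c•w}² ≡ e_{c•w} (p)`), and `εW ≫ e = ι ≫ β(e_w) ≫ e₀ ≫ ι^D = ι ≫ e₀ ≫ β(e_{c•w})^D ≫ ι^D = e ≫ εV^D` (`e_{c•w}† ≡ e_w (p)`).

* **`exists_twoBlock_hermitianDuality`** — THE HEAD (generic `𝒪`, bare `star`; the congruences as hypotheses in the `e′ = e + p • c` currency of ★
  `TorsionLayerBlockIdempotents`).
* §0 (ED. 2) **`exists_blockIdempotents`** — the ring-side hypotheses DISCHARGED for `𝒪 = 𝓞 F` (`F` CM), `I = 𝔭_w𝔭_{c•w}`, `star = (c • ·)`, `p` unramified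
  at `w` and `c•w` (CRT in the Dedekind domain `𝓞 F`: `(p) = 𝔭_w 𝔭_{c•w} 𝔟` pairwise comaximal, `c•𝔟 = 𝔟`).
* §1 (ED. 3) **`exists_twoBlock_hermitianDuality_pairing`** — the head WITH ITS PAIRING-VALUE CLAUSE `⟪t ≫ e, s⟫ = e_p(s ≫ j′, (t ≫ j′) ≫ λ)` on finite points
  (★ `exists_hermitianDuality_of_polarization_pairing` + ★ `exists_blockDuality`'s formula + ★ `cartierPairing_comp_cartierDualMap`), the seam to ★ (ISO-q).
* §0′ (ED. 4) **`exists_blockIdempotents_mem`** — §0's elements with the two block-membership rows `ew ∈ 𝔭_{c•w}`, `ecw ∈ 𝔭_w` (which idempotent cuts which block).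

## References
* [MumfordAV1970] D. Mumford, *Abelian Varieties* (1970), §20 (I) (p. 189), §15 Thm. 1 (p. 143).
* [Tate1997FiniteFlatGroupSchemes] J. Tate, *Finite flat group schemes* (1997), §(3.7)–(3.8) pp. 145–146.
* [Tate1967] J. T. Tate, *p-divisible groups* (1967), §2.2.
* [Neukirch1999] J. Neukirch, *Algebraic Number Theory* (1999), Ch. I §3 (3.6).
-/

set_option autoImplicit false

-- Mathlib's `Over`/`Scheme` APIs are stated across semireducible wrappers (as in the ★ `GroupSchemes/*` files).
set_option backward.isDefEq.respectTransparency false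

noncomputable section

universe u

open CategoryTheory CategoryTheory.Limits AlgebraicGeometry MonoidalCategory CartesianMonoidalCategory
open scoped MonObj

namespace Literature.AlgebraicGeometry.AbelianSchemes

namespace AbelianSchemeOver

namespace DualPair

open Literature.AlgebraicGeometry.GroupSchemes Literature.AlgebraicGeometry.GroupSchemes.GroupSchemeKernel
open Literature.AlgebraicGeometry.GroupSchemes.AffineGroupScheme Literature.AlgebraicGeometry.GroupSchemes.TorsionLayer
open Literature.AlgebraicGeometry.Motives Literature.AlgebraicGeometry.Motives.AbelianVariety

variable {k : Type u} [Field k]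

set_option maxHeartbeats 400000 in
/-- **THE TWO-BLOCK CUT OF THE HERMITIAN WEIL DUALITY.**  Over ANY field `k`, for ANY prime `p`: `A` an abelian variety with a normalised dual pair `D`, a
polarization `λ` with `λ|_{A[p]}` killing no non-trivial `T`-point (`hlam`), realisations `j : G ↪ A` of `A[p]`, `ĵ : Ĝ ↪ Â` of `Â[p]`, labels `O` (a
commutative ring) with bare `star`, `act : O → End A`, layer endomorphisms `β` of `G` over `act` (`hβ`) which are unital, additive and anti-multiplicative,
the Rosati adjunction `hRos`, an ideal `I ∋ p` of `O` with `act p = [p]`, and elements `ew`, `ecw` with: `ew + ecw - 1 ∈ I`, `I·(ew+ecw) ⊆ p•O`,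
`ew² ≡ ew`, `ecw² ≡ ecw`, `(ew+ecw)² ≡ ew+ecw`, `star ecw ≡ ew`, `star (ew+ecw) ≡ ew+ecw` modulo `p` (all in the `e′ = e + p • c` currency).  THEN there are a
realisation `j′ : G′ ↪ A` of `A[I]` (commutative, affine, `Γ` finite free; points clause), a perfect duality `e : G′ ≅ G′^D` (a homomorphism), and layer
endomorphisms `εW`, `εV` of `G′` over `act ew`, `act ecw` (homomorphisms) with `εW * εV = 𝟙`, `εV ≫ εV = εV`, `εW ≫ εW = εW` and `εW ≫ e = e ≫ εV^D`
— the INPUT tokens of ★ (BLK) `exists_comp_eq_iff_of_lagrangian_of_blocks`.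
[cite: MumfordAV1970, §20 (I) (p. 189)] [cite: Tate1997FiniteFlatGroupSchemes, §(3.8) pp. 145–146] [cite: Tate1967, §2.2] -/
theorem exists_twoBlock_hermitianDuality (p : ℕ) [Fact p.Prime] (A : AbelianVariety k)
    (D : (AbelianScheme.ofAbelianVariety A).toOver.DualPair)
    (hD : Nonempty ((Scheme.Modules.pullback D.unitHatSlice).obj D.P ≅ SheafOfModules.unit _))
    (pol : (AbelianScheme.ofAbelianVariety A).toOver.Polarization D)
    (G : SchemeOver k) [GrpObj G] [IsCommMonObj G] [IsAffine G.left] [Module.Free k (Alg G)] [Module.Finite k (Alg G)]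
    (j : G ⟶ A.X) [IsMonHom j] [IsClosedImmersion j.left]
    (hG : ∀ ⦃T : SchemeOver k⦄ (t : T ⟶ A.X), (∃ s : T ⟶ G, s ≫ j = t) ↔ t ≫ ((((p ^ 1 : ℕ) : ℤ) • 𝟙 A).hom.hom.hom) = 1)
    (Ĝ : SchemeOver k) [GrpObj Ĝ] [IsCommMonObj Ĝ] [IsAffine Ĝ.left] [Module.Free k (Alg Ĝ)] [Module.Finite k (Alg Ĝ)]
    (ĵ : Ĝ ⟶ D.hat.X) [IsMonHom ĵ] [IsClosedImmersion ĵ.left]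
    (hĜ : ∀ ⦃T : SchemeOver k⦄ (t : T ⟶ D.hat.X),
      (∃ s : T ⟶ Ĝ, s ≫ ĵ = t) ↔ t ≫ ((((p ^ 1 : ℕ) : ℤ) • 𝟙 D.hat.toAffine.toAbelianVariety).hom.hom.hom) = 1)
    (hlam : ∀ ⦃T : SchemeOver k⦄ (t : T ⟶ G), (t ≫ j) ≫ pol.lam = 1 → t = 1)
    (O : Type) [CommRing O] (star : O → O) (act : O → (A ⟶ A)) (β : O → (G ⟶ G)) [∀ a, IsMonHom (β a)]
    (hβ : ∀ a, β a ≫ j = j ≫ (act a).hom.hom.hom)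
    (hβone : β 1 = 𝟙 G) (hβadd : ∀ a b, β (a + b) = β a * β b) (hβmul : ∀ a b, β (a * b) = β b ≫ β a)
    (hRos : ∀ a, (act (star a)).hom.hom.hom ≫ pol.lam =
      pol.lam ≫ dualIsogenyOver (A' := (AbelianScheme.ofAbelianVariety A).toOver) (B := (AbelianScheme.ofAbelianVariety A).toOver)
        (act a).hom.hom.hom D D)
    -- the two-block ideal and the CRT elements
    (I : Ideal O) (hpI : (p : O) ∈ I) (hactp : (act (p : O)).hom.hom.hom = ((((p ^ 1 : ℕ) : ℤ) • 𝟙 A).hom.hom.hom))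
    (ew ecw : O) (hsum : ew + ecw - 1 ∈ I) (hI : ∀ a ∈ I, ∃ c : O, a * (ew + ecw) = p • c)
    (hew : ∃ c : O, ew * ew = ew + p • c) (hecw : ∃ c : O, ecw * ecw = ecw + p • c)
    (hsq : ∃ c : O, (ew + ecw) * (ew + ecw) = (ew + ecw) + p • c)
    (hstar₁ : ∃ c : O, star ecw = ew + p • c) (hstar₂ : ∃ c : O, star (ew + ecw) = (ew + ecw) + p • c) :
    ∃ (G' : SchemeOver k) (_ : GrpObj G') (_ : IsCommMonObj G') (_ : IsAffine G'.left) (_ : Module.Free k (Alg G')) (_ : Module.Finite k (Alg G'))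
      (j' : G' ⟶ A.X) (_ : IsMonHom j') (_ : IsClosedImmersion j'.left)
      (e : G' ≅ cartierDual G') (_ : IsMonHom e.hom)
      (εW εV : G' ⟶ G') (_ : IsMonHom εW) (_ : IsMonHom εV),
      (∀ ⦃T : SchemeOver k⦄ (t : T ⟶ A.X), (∃ s : T ⟶ G', s ≫ j' = t) ↔ ∀ a ∈ I, t ≫ (act a).hom.hom.hom = 1) ∧
      εW ≫ j' = j' ≫ (act ew).hom.hom.hom ∧ εV ≫ j' = j' ≫ (act ecw).hom.hom.hom ∧
      εW * εV = 𝟙 G' ∧ εV ≫ εV = εV ∧ εW ≫ εW = εW ∧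
      εW ≫ e.hom = e.hom ≫ cartierDualMap εV := by
  haveI : Mono j := Over.mono_of_mono_left j
  -- (0) the hermitian Weil duality `e₀ : G ≅ G^D` (★ (W-λ) H1 at `r = 1`) and `[p]_G = 1`
  obtain ⟨e₀, he₀mon, hherm⟩ := exists_hermitianDuality_of_polarization p 1 A D hD pol G j hG Ĝ ĵ hĜ hlam O star act β hβ hRos
  haveI := he₀mon
  obtain ⟨-, -, -, hN⟩ := exists_layerEnd_abelianVariety A (p ^ 1) G j hG act
  rw [pow_one] at hN
  -- (1) the self-adjoint idempotent `ε := β (ew + ecw)` and its fixed layer `G′`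
  obtain ⟨c₃, hc₃⟩ := hsq
  have hεε : β (ew + ecw) ≫ β (ew + ecw) = β (ew + ecw) := layerEnd_idem_of_mul_self_eq β hβadd hβmul hN hc₃
  have hεstar : β (star (ew + ecw)) = β (ew + ecw) := by
    obtain ⟨c, hc⟩ := hstar₂
    exact layerEnd_eq_of_eq_add_nsmul β hβadd hN hc
  have hadj₀ : β (ew + ecw) ≫ e₀.hom = e₀.hom ≫ cartierDualMap (β (ew + ecw)) := by
    have h := hherm (ew + ecw)
    rw [hεstar] at h
    exact h
  obtain ⟨W, grpW, commW, affW, freeW, finW, jW, monW, ciW, hW⟩ := exists_fixedLayer G (β (ew + ecw))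
  haveI : Mono jW := Over.mono_of_mono_left jW
  have hjWε : jW ≫ β (ew + ecw) = jW := (hW jW).1 ⟨𝟙 W, Category.id_comp jW⟩
  -- (2) the block duality `e : W ≅ W^D`
  obtain ⟨e, hemon, he⟩ := exists_blockDuality G e₀ (β (ew + ecw)) (β (ew + ecw)) hεε hεε hadj₀ W jW hW W jW hW
  -- (3) the two layer endomorphisms `εW`, `εV` of `W` (`β ew`, `β ecw` commute with `ε`)
  have hcommW : β ew ≫ β (ew + ecw) = β (ew + ecw) ≫ β ew := by rw [← hβmul, ← hβmul, mul_comm]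
  have hcommV : β ecw ≫ β (ew + ecw) = β (ew + ecw) ≫ β ecw := by rw [← hβmul, ← hβmul, mul_comm]
  obtain ⟨εW, hεW⟩ := (hW (jW ≫ β ew)).2 (by rw [Category.assoc, hcommW, ← Category.assoc, hjWε])
  obtain ⟨εV, hεV⟩ := (hW (jW ≫ β ecw)).2 (by rw [Category.assoc, hcommV, ← Category.assoc, hjWε])
  haveI : IsMonHom (εW ≫ jW) := by rw [hεW]; infer_instance
  haveI : IsMonHom (εV ≫ jW) := by rw [hεV]; infer_instance
  haveI hεWmon : IsMonHom εW := isMonHom_of_comp jW εW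
  haveI hεVmon : IsMonHom εV := isMonHom_of_comp jW εV
  refine ⟨W, grpW, commW, affW, freeW, finW, jW ≫ j, inferInstance, ?_, e, hemon, εW, εV, hεWmon, hεVmon, ?_, ?_, ?_, ?_, ?_, ?_, ?_⟩
  · rw [Over.comp_left]; infer_instance
  · -- POINTS: `G′` realises `A[I]`
    intro T t
    constructor
    · rintro ⟨s, rfl⟩ a ha
      obtain ⟨c, hc⟩ := hI a ha
      have hkill : β (ew + ecw) ≫ β a = 1 := by
        rw [← hβmul, hc, layerEnd_nsmul β hβadd, ← Category.comp_id (β c), ← MonObj.comp_pow, hN, MonObj.comp_one]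
      rw [Category.assoc, Category.assoc, ← hβ a, ← Category.assoc jW, ← hjWε, Category.assoc jW, hkill, MonObj.comp_one, MonObj.one_comp,
        MonObj.comp_one]
    · intro ht
      have htp : t ≫ ((((p ^ 1 : ℕ) : ℤ) • 𝟙 A).hom.hom.hom) = 1 := by rw [← hactp]; exact ht _ hpI
      obtain ⟨s₀, hs₀⟩ := (hG t).2 htp
      -- `s₀` is fixed by `ε`: `s₀ ≫ β(ew+ecw) = s₀ · (s₀ ≫ β m)`, `m = ew + ecw - 1 ∈ I` kills `t`
      have hm : s₀ ≫ β (ew + ecw - 1) = 1 := by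
        rw [← cancel_mono j, Category.assoc, hβ, ← Category.assoc, hs₀, ht _ hsum, MonObj.one_comp]
      have hfix : s₀ ≫ β (ew + ecw) = s₀ := by
        have : ew + ecw = 1 + (ew + ecw - 1) := by ring
        rw [this, hβadd, MonObj.comp_mul, hβone, Category.comp_id, hm, mul_one]
      obtain ⟨s, hs⟩ := (hW s₀).2 hfix
      exact ⟨s, by rw [← Category.assoc, hs, hs₀]⟩
  · rw [← Category.assoc, hεW, Category.assoc, hβ, Category.assoc]
  · rw [← Category.assoc, hεV, Category.assoc, hβ, Category.assoc]
  · -- `εW * εV = 𝟙`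
    rw [← cancel_mono jW, MonObj.mul_comp, hεW, hεV, ← MonObj.comp_mul, ← hβadd, hjWε, Category.id_comp]
  · -- `εV ≫ εV = εV`
    obtain ⟨c, hc⟩ := hecw
    rw [← cancel_mono jW, Category.assoc, hεV, ← Category.assoc, hεV, Category.assoc, layerEnd_idem_of_mul_self_eq β hβadd hβmul hN hc]
  · -- `εW ≫ εW = εW`
    obtain ⟨c, hc⟩ := hew
    rw [← cancel_mono jW, Category.assoc, hεW, ← Category.assoc, hεW, Category.assoc, layerEnd_idem_of_mul_self_eq β hβadd hβmul hN hc]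
  · -- the Rosati adjointness on the cut: `εW ≫ e = e ≫ εV^D`
    have hβstar : β (star ecw) = β ew := by
      obtain ⟨c, hc⟩ := hstar₁
      exact layerEnd_eq_of_eq_add_nsmul β hβadd hN hc
    rw [← he, ← Category.assoc, ← Category.assoc, hεW, Category.assoc jW, ← hβstar, hherm ecw, Category.assoc, Category.assoc, Category.assoc,
      ← cartierDualMap_comp, ← cartierDualMap_congr hεV, cartierDualMap_comp]
    simp only [Category.assoc]

end DualPair

end AbelianSchemeOver

/-! ## §0 (ED. 2) The CRT elements for `𝒪 = 𝓞 F`, `I = 𝔭_w 𝔭_{c•w}`, `star = c` — the ring-side hypotheses of the head, discharged -/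

namespace AbelianSchemeOver

open IsDedekindDomain NumberField
open scoped Pointwise

set_option maxHeartbeats 400000 in
/-- **THE TWO CRT ELEMENTS `e_w, e_{c•w}` OF `𝓞 F` MODULO `p`** (ED. 2): for a CM field `F`, a finite place `w` with `c•w ≠ w` over the rational prime `p`,
UNRAMIFIED at `w` and at `c•w` (so `(p) = 𝔭_w 𝔭_{c•w} 𝔟` with pairwise comaximal factors), there are `ew ≡ (1,0,0)` and `ecw ≡ (0,1,0)` modulo
`𝔭_w × 𝔭_{c•w} × 𝔟` with exactly the congruences the head `exists_twoBlock_hermitianDuality` consumes (`I := 𝔭_w𝔭_{c•w}`, `star := (c • ·)`):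
`ew + ecw - 1 ∈ I`, `I·(ew+ecw) ⊆ p•𝒪`, `ew² ≡ ew`, `ecw² ≡ ecw`, `(ew+ecw)² ≡ ew+ecw`, `c•ecw ≡ ew`, `c•(ew+ecw) ≡ ew+ecw` modulo `p`, and `p ∈ I`.
[cite: Neukirch1999, Ch. I §3 (3.6)] [cite: Tate1967, §2.2] -/
theorem exists_blockIdempotents {F : Type} [Field F] [NumberField F] [IsCMField F]
    (w : HeightOneSpectrum (𝓞 F)) (hw : (IsCMField.complexConj F) • w ≠ w)
    {p : ℕ} (hpw : (p : 𝓞 F) ∈ w.asIdeal)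
    (hunr : ¬ w.asIdeal ^ 2 ∣ Ideal.span {(p : 𝓞 F)}) (hunr' : ¬ ((IsCMField.complexConj F) • w).asIdeal ^ 2 ∣ Ideal.span {(p : 𝓞 F)}) :
    ∃ ew ecw : 𝓞 F,
      ew + ecw - 1 ∈ w.asIdeal * ((IsCMField.complexConj F) • w).asIdeal ∧
      (∀ a ∈ w.asIdeal * ((IsCMField.complexConj F) • w).asIdeal, ∃ c : 𝓞 F, a * (ew + ecw) = p • c) ∧
      (∃ c : 𝓞 F, ew * ew = ew + p • c) ∧ (∃ c : 𝓞 F, ecw * ecw = ecw + p • c) ∧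
      (∃ c : 𝓞 F, (ew + ecw) * (ew + ecw) = (ew + ecw) + p • c) ∧
      (∃ c : 𝓞 F, (IsCMField.complexConj F) • ecw = ew + p • c) ∧
      (∃ c : 𝓞 F, (IsCMField.complexConj F) • (ew + ecw) = (ew + ecw) + p • c) ∧
      (p : 𝓞 F) ∈ w.asIdeal * ((IsCMField.complexConj F) • w).asIdeal := by
  classical
  set cc := IsCMField.complexConj F with hccdef
  set 𝔭 : Ideal (𝓞 F) := w.asIdeal with h𝔭def
  set 𝔮 : Ideal (𝓞 F) := (cc • w).asIdeal with h𝔮def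
  have h𝔮𝔭 : 𝔮 = cc • 𝔭 := rfl
  have h𝔭𝔮ne : 𝔭 ≠ 𝔮 := fun h => hw (HeightOneSpectrum.ext h.symm)
  haveI : 𝔭.IsMaximal := w.isMaximal
  haveI : 𝔮.IsMaximal := (cc • w).isMaximal
  -- conjugation on elements
  have hccp : cc • ((p : 𝓞 F)) = (p : 𝓞 F) := by
    simpa only [MulSemiringAction.toRingHom_apply] using map_natCast (MulSemiringAction.toRingHom _ (𝓞 F) cc) p
  have hconj_coe : ∀ b : 𝓞 F, ((cc • b : 𝓞 F) : F) = cc (b : F) := fun _ => rfl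
  have hconj_conj : ∀ b : 𝓞 F, cc • (cc • b) = b := fun b => by
    apply RingOfIntegers.ext
    rw [hconj_coe, hconj_coe, hccdef, IsCMField.complexConj_apply_apply]
  have hmem𝔮 : ∀ b : 𝓞 F, cc • b ∈ 𝔮 ↔ b ∈ 𝔭 := fun b => by rw [h𝔮𝔭]; exact Ideal.smul_mem_pointwise_smul_iff
  have hmem𝔭 : ∀ b : 𝓞 F, cc • b ∈ 𝔭 ↔ b ∈ 𝔮 := fun b => by rw [← hmem𝔮, hconj_conj]
  have hp𝔮 : (p : 𝓞 F) ∈ 𝔮 := by rw [← hccp]; exact (hmem𝔮 _).2 hpw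
  -- `(p) = 𝔭 𝔮 𝔟`, pairwise comaximal
  obtain ⟨J₁, hJ₁⟩ := Ideal.dvd_span_singleton.mpr hpw
  have h𝔮dvdJ₁ : 𝔮 ∣ J₁ := by
    have h : 𝔮 ∣ 𝔭 * J₁ := hJ₁ ▸ Ideal.dvd_span_singleton.mpr hp𝔮
    rcases (Ideal.prime_of_isPrime (cc • w).ne_bot inferInstance).dvd_or_dvd h with h' | h'
    · exact absurd (Ideal.IsMaximal.eq_of_le inferInstance (Ideal.IsPrime.ne_top inferInstance) (Ideal.dvd_iff_le.mp h')) h𝔭𝔮ne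
    · exact h'
  obtain ⟨𝔟, h𝔟⟩ := h𝔮dvdJ₁
  have hfac : Ideal.span {(p : 𝓞 F)} = 𝔭 * 𝔮 * 𝔟 := by rw [hJ₁, h𝔟, mul_assoc]
  have h𝔭𝔟 : 𝔭 ⊔ 𝔟 = ⊤ := by
    by_contra hne
    have e : 𝔭 = 𝔭 ⊔ 𝔟 := Ideal.IsMaximal.eq_of_le inferInstance hne le_sup_left
    have h𝔟le : 𝔟 ≤ 𝔭 := calc 𝔟 ≤ 𝔭 ⊔ 𝔟 := le_sup_right
      _ = 𝔭 := e.symm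
    obtain ⟨𝔠, h𝔠⟩ := Ideal.dvd_iff_le.mpr h𝔟le
    exact hunr ⟨𝔮 * 𝔠, by rw [hfac, h𝔠]; ring⟩
  have h𝔮𝔟 : 𝔮 ⊔ 𝔟 = ⊤ := by
    by_contra hne
    have e : 𝔮 = 𝔮 ⊔ 𝔟 := Ideal.IsMaximal.eq_of_le inferInstance hne le_sup_left
    have h𝔟le : 𝔟 ≤ 𝔮 := calc 𝔟 ≤ 𝔮 ⊔ 𝔟 := le_sup_right
      _ = 𝔮 := e.symm
    obtain ⟨𝔠, h𝔠⟩ := Ideal.dvd_iff_le.mpr h𝔟le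
    exact hunr' ⟨𝔭 * 𝔠, by rw [hfac, h𝔠]; ring⟩
  have h𝔭𝔮 : 𝔭 ⊔ 𝔮 = ⊤ := Ideal.IsMaximal.coprime_of_ne inferInstance inferInstance h𝔭𝔮ne
  have h𝔭_𝔮𝔟 : 𝔭 ⊔ 𝔮 * 𝔟 = ⊤ := Ideal.isCoprime_iff_sup_eq.mp
    (IsCoprime.mul_right (Ideal.isCoprime_iff_sup_eq.mpr h𝔭𝔮) (Ideal.isCoprime_iff_sup_eq.mpr h𝔭𝔟))
  have h𝔮_𝔭𝔟 : 𝔮 ⊔ 𝔭 * 𝔟 = ⊤ := Ideal.isCoprime_iff_sup_eq.mp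
    (IsCoprime.mul_right (Ideal.isCoprime_iff_sup_eq.mpr ((sup_comm 𝔮 𝔭).trans h𝔭𝔮)) (Ideal.isCoprime_iff_sup_eq.mpr h𝔮𝔟))
  have h𝔭𝔮_𝔟 : 𝔭 * 𝔮 ⊔ 𝔟 = ⊤ := Ideal.isCoprime_iff_sup_eq.mp
    (IsCoprime.mul_left (Ideal.isCoprime_iff_sup_eq.mpr h𝔭𝔟) (Ideal.isCoprime_iff_sup_eq.mpr h𝔮𝔟))
  have hp𝔭𝔮 : (p : 𝓞 F) ∈ 𝔭 * 𝔮 := Ideal.dvd_span_singleton.mp ⟨𝔟, hfac⟩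
  -- `c • 𝔟 = 𝔟` (cancel `𝔭𝔮` in `c • (p) = (p)`)
  have hcc2 : cc * cc = 1 := AlgEquiv.ext fun x => by
    rw [AlgEquiv.mul_apply, AlgEquiv.one_apply, hccdef, IsCMField.complexConj_apply_apply]
  have hc𝔮 : cc • 𝔮 = 𝔭 := by rw [h𝔮𝔭, smul_smul, hcc2, one_smul]
  have hc𝔟 : cc • 𝔟 = 𝔟 := by
    have h1 : cc • Ideal.span {(p : 𝓞 F)} = Ideal.span {(p : 𝓞 F)} := by
      rw [Ideal.pointwise_smul_def, Ideal.map_span, Set.image_singleton, MulSemiringAction.toRingHom_apply, hccp]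
    rw [hfac, smul_mul', smul_mul', ← h𝔮𝔭, hc𝔮] at h1
    have h2 : (𝔭 * 𝔮) * (cc • 𝔟) = (𝔭 * 𝔮) * 𝔟 := by rw [← h1]; ring
    exact mul_left_cancel₀ (mul_ne_zero w.ne_bot (cc • w).ne_bot) h2
  -- `span {p} = 𝔭 ⊓ 𝔮 ⊓ 𝔟` and its elements are `p`-multiples
  have hinf : ∀ x : 𝓞 F, x ∈ 𝔭 → x ∈ 𝔮 → x ∈ 𝔟 → x ∈ Ideal.span {(p : 𝓞 F)} := fun x h1 h2 h3 => by
    rw [hfac, Ideal.mul_eq_inf_of_coprime h𝔭𝔮_𝔟, Ideal.mul_eq_inf_of_coprime h𝔭𝔮]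
    exact ⟨⟨h1, h2⟩, h3⟩
  have hspan_p : ∀ x ∈ Ideal.span {(p : 𝓞 F)}, ∃ c : 𝓞 F, x = p • c := fun x hx => by
    obtain ⟨a, ha⟩ := Ideal.mem_span_singleton'.mp hx
    exact ⟨a, by rw [nsmul_eq_mul, mul_comm, ha]⟩
  have hle₁ : 𝔮 * 𝔟 * 𝔭 ≤ Ideal.span {(p : 𝓞 F)} := by rw [hfac]; exact le_of_eq (by ring)
  have hle₂ : 𝔭 * 𝔟 * 𝔮 ≤ Ideal.span {(p : 𝓞 F)} := by rw [hfac]; exact le_of_eq (by ring)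
  have hle₃ : (𝔮 * 𝔟) * (𝔭 * 𝔟) ≤ Ideal.span {(p : 𝓞 F)} := by
    rw [hfac]
    calc (𝔮 * 𝔟) * (𝔭 * 𝔟) = (𝔭 * 𝔮 * 𝔟) * 𝔟 := by ring
      _ ≤ 𝔭 * 𝔮 * 𝔟 := Ideal.mul_le_right
  have hle₄ : (𝔭 * 𝔮) * (𝔮 * 𝔟) ≤ Ideal.span {(p : 𝓞 F)} := by
    rw [hfac]
    calc (𝔭 * 𝔮) * (𝔮 * 𝔟) = (𝔭 * 𝔮 * 𝔟) * 𝔮 := by ring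
      _ ≤ 𝔭 * 𝔮 * 𝔟 := Ideal.mul_le_right
  have hle₅ : (𝔭 * 𝔮) * (𝔭 * 𝔟) ≤ Ideal.span {(p : 𝓞 F)} := by
    rw [hfac]
    calc (𝔭 * 𝔮) * (𝔭 * 𝔟) = (𝔭 * 𝔮 * 𝔟) * 𝔭 := by ring
      _ ≤ 𝔭 * 𝔮 * 𝔟 := Ideal.mul_le_right
  -- THE ELEMENTS: `1 = a₁ + ew`, `a₁ ∈ 𝔭`, `ew ∈ 𝔮𝔟`; `1 = a₂ + ecw`, `a₂ ∈ 𝔮`, `ecw ∈ 𝔭𝔟`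
  obtain ⟨a₁, ha₁, ew, hew, h₁⟩ := Submodule.mem_sup.mp ((Ideal.eq_top_iff_one _).mp h𝔭_𝔮𝔟)
  obtain ⟨a₂, ha₂, ecw, hecw, h₂⟩ := Submodule.mem_sup.mp ((Ideal.eq_top_iff_one _).mp h𝔮_𝔭𝔟)
  have hew𝔮 : ew ∈ 𝔮 := Ideal.mul_le_right hew
  have hew𝔟 : ew ∈ 𝔟 := Ideal.mul_le_left hew
  have hecw𝔭 : ecw ∈ 𝔭 := Ideal.mul_le_right hecw
  have hecw𝔟 : ecw ∈ 𝔟 := Ideal.mul_le_left hecw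
  have hew1 : ew - 1 = -a₁ := by rw [← h₁]; ring
  have hecw1 : ecw - 1 = -a₂ := by rw [← h₂]; ring
  -- the squares
  have hsq₁ : ew * ew - ew ∈ Ideal.span {(p : 𝓞 F)} := by
    have : ew * ew - ew = ew * (ew - 1) := by ring
    rw [this, hew1, mul_neg]
    exact Submodule.neg_mem _ (hle₁ (Ideal.mul_mem_mul hew ha₁))
  have hsq₂ : ecw * ecw - ecw ∈ Ideal.span {(p : 𝓞 F)} := by
    have : ecw * ecw - ecw = ecw * (ecw - 1) := by ring
    rw [this, hecw1, mul_neg]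
    exact Submodule.neg_mem _ (hle₂ (Ideal.mul_mem_mul hecw ha₂))
  have hprod : ew * ecw ∈ Ideal.span {(p : 𝓞 F)} := hle₃ (Ideal.mul_mem_mul hew hecw)
  -- the conjugates: `c•ecw - ew`, `c•ew - ecw ∈ (p)`
  have hst₁ : cc • ecw - ew ∈ Ideal.span {(p : 𝓞 F)} := by
    have e : cc • ecw = 1 - cc • a₂ := by rw [eq_sub_iff_add_eq, ← smul_add, add_comm, h₂, smul_one]
    refine hinf _ ?_ ?_ ?_
    · rw [e, show (1 : 𝓞 F) - cc • a₂ - ew = a₁ - cc • a₂ by rw [← h₁]; ring]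
      exact Submodule.sub_mem _ ha₁ ((hmem𝔭 a₂).2 ha₂)
    · exact Submodule.sub_mem _ ((hmem𝔮 ecw).2 hecw𝔭) hew𝔮
    · exact Submodule.sub_mem _ (hc𝔟 ▸ Ideal.smul_mem_pointwise_smul_iff.2 hecw𝔟) hew𝔟
  have hst₂ : cc • ew - ecw ∈ Ideal.span {(p : 𝓞 F)} := by
    have e : cc • ew = 1 - cc • a₁ := by rw [eq_sub_iff_add_eq, ← smul_add, add_comm, h₁, smul_one]
    refine hinf _ ?_ ?_ ?_
    · exact Submodule.sub_mem _ ((hmem𝔭 ew).2 hew𝔮) hecw𝔭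
    · rw [e, show (1 : 𝓞 F) - cc • a₁ - ecw = a₂ - cc • a₁ by rw [← h₂]; ring]
      exact Submodule.sub_mem _ ha₂ ((hmem𝔮 a₁).2 ha₁)
    · exact Submodule.sub_mem _ (hc𝔟 ▸ Ideal.smul_mem_pointwise_smul_iff.2 hew𝔟) hecw𝔟
  refine ⟨ew, ecw, ?_, ?_, ?_, ?_, ?_, ?_, ?_, hp𝔭𝔮⟩
  · -- `ew + ecw - 1 ∈ 𝔭𝔮 = 𝔭 ⊓ 𝔮`
    rw [Ideal.mul_eq_inf_of_coprime h𝔭𝔮]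
    refine ⟨?_, ?_⟩
    · rw [show ew + ecw - 1 = ecw - a₁ by rw [← h₁]; ring]; exact Submodule.sub_mem _ hecw𝔭 ha₁
    · rw [show ew + ecw - 1 = ew - a₂ by rw [← h₂]; ring]; exact Submodule.sub_mem _ hew𝔮 ha₂
  · -- `I·(ew + ecw) ⊆ (p)`
    intro a ha
    apply hspan_p
    rw [mul_add]
    exact Submodule.add_mem _ (hle₄ (Ideal.mul_mem_mul ha hew)) (hle₅ (Ideal.mul_mem_mul ha hecw))
  · obtain ⟨c, hc⟩ := hspan_p _ hsq₁
    exact ⟨c, by rw [← hc]; ring⟩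
  · obtain ⟨c, hc⟩ := hspan_p _ hsq₂
    exact ⟨c, by rw [← hc]; ring⟩
  · have h : (ew + ecw) * (ew + ecw) - (ew + ecw) ∈ Ideal.span {(p : 𝓞 F)} := by
      have : (ew + ecw) * (ew + ecw) - (ew + ecw) = (ew * ew - ew) + (ecw * ecw - ecw) + 2 * (ew * ecw) := by ring
      rw [this]
      exact Submodule.add_mem _ (Submodule.add_mem _ hsq₁ hsq₂) (Ideal.mul_mem_left _ _ hprod)
    obtain ⟨c, hc⟩ := hspan_p _ h
    exact ⟨c, by rw [← hc]; ring⟩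
  · obtain ⟨c, hc⟩ := hspan_p _ hst₁
    exact ⟨c, by rw [← hc]; ring⟩
  · have h : cc • (ew + ecw) - (ew + ecw) ∈ Ideal.span {(p : 𝓞 F)} := by
      have : cc • (ew + ecw) - (ew + ecw) = (cc • ew - ecw) + (cc • ecw - ew) := by rw [smul_add]; ring
      rw [this]
      exact Submodule.add_mem _ hst₂ hst₁
    obtain ⟨c, hc⟩ := hspan_p _ h
    exact ⟨c, by rw [← hc]; ring⟩

/-! ## §1 (ED. 3) THE TWO-BLOCK CUT WITH ITS PAIRING-VALUE CLAUSE (organ (LAG-b) of line L2) -/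

namespace DualPair

open Literature.AlgebraicGeometry.GroupSchemes Literature.AlgebraicGeometry.GroupSchemes.GroupSchemeKernel
open Literature.AlgebraicGeometry.GroupSchemes.AffineGroupScheme Literature.AlgebraicGeometry.GroupSchemes.TorsionLayer
open Literature.AlgebraicGeometry.Motives Literature.AlgebraicGeometry.Motives.AbelianVariety

variable {k : Type u} [Field k]

set_option maxHeartbeats 400000 in
/-- **THE TWO-BLOCK CUT OF THE HERMITIAN WEIL DUALITY, WITH ITS PAIRING VALUES** (ED. 3, add-only).  Same data, hypotheses and conclusions as
`exists_twoBlock_hermitianDuality` — the realisation `j′ : G′ ↪ A` of `A[I]`, the perfect duality `e : G′ ≅ G′^D`, the layer idempotents `εW`, `εV` with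
`εW · εV = 𝟙`, `εV² = εV`, `εW² = εW`, `εW ≫ e = e ≫ εV^D` — PLUS the clause saying WHICH duality `e` is: on points over FINITE `k`-algebras `T`,
`⟪t ≫ e, s⟫ = e_p(s ≫ j′, (t ≫ j′) ≫ λ)` (★ `weilChar`; torsion witnesses quantified).  Indeed `e = jW ≫ e₀ ≫ jW^D` (★ `exists_blockDuality`) for the
hermitian duality `e₀ = ℓ ≫ w_A` of `A[p]` whose pairing values are `e_p(·, λ·)` (★ `exists_hermitianDuality_of_polarization_pairing`, ED. 2 of ★ (W-λ) H1), and
`⟪c ≫ jW^D, s⟫ = ⟪c, s ≫ jW⟫` (★ `cartierPairing_comp_cartierDualMap`).  This is the clause through which ★ (ISO-q) `weilUnit_comp_lam_eq_one_of_comp_eq_one`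
([MumfordAV1970] §23 Thm. 2) makes the kernels `Ker r̄ ⊂ G′` of homomorphisms with `r̄^*λ′ = p·λ` ISOTROPIC for `e` — the `hlagᵢ` input of ★ (BLK)
`exists_comp_eq_iff_of_lagrangian_of_blocks`.
[cite: MumfordAV1970, §20 (I) (p. 189), §15 Thm. 1 (p. 143), §23 Thm. 2 (p. 231)] [cite: Tate1997FiniteFlatGroupSchemes, §(3.8) pp. 145–146] -/
theorem exists_twoBlock_hermitianDuality_pairing (p : ℕ) [Fact p.Prime] (A : AbelianVariety k)
    (D : (AbelianScheme.ofAbelianVariety A).toOver.DualPair)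
    (hD : Nonempty ((Scheme.Modules.pullback D.unitHatSlice).obj D.P ≅ SheafOfModules.unit _))
    (pol : (AbelianScheme.ofAbelianVariety A).toOver.Polarization D)
    (G : SchemeOver k) [GrpObj G] [IsCommMonObj G] [IsAffine G.left] [Module.Free k (Alg G)] [Module.Finite k (Alg G)]
    (j : G ⟶ A.X) [IsMonHom j] [IsClosedImmersion j.left]
    (hG : ∀ ⦃T : SchemeOver k⦄ (t : T ⟶ A.X), (∃ s : T ⟶ G, s ≫ j = t) ↔ t ≫ ((((p ^ 1 : ℕ) : ℤ) • 𝟙 A).hom.hom.hom) = 1)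
    (Ĝ : SchemeOver k) [GrpObj Ĝ] [IsCommMonObj Ĝ] [IsAffine Ĝ.left] [Module.Free k (Alg Ĝ)] [Module.Finite k (Alg Ĝ)]
    (ĵ : Ĝ ⟶ D.hat.X) [IsMonHom ĵ] [IsClosedImmersion ĵ.left]
    (hĜ : ∀ ⦃T : SchemeOver k⦄ (t : T ⟶ D.hat.X),
      (∃ s : T ⟶ Ĝ, s ≫ ĵ = t) ↔ t ≫ ((((p ^ 1 : ℕ) : ℤ) • 𝟙 D.hat.toAffine.toAbelianVariety).hom.hom.hom) = 1)
    (hlam : ∀ ⦃T : SchemeOver k⦄ (t : T ⟶ G), (t ≫ j) ≫ pol.lam = 1 → t = 1)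
    (O : Type) [CommRing O] (star : O → O) (act : O → (A ⟶ A)) (β : O → (G ⟶ G)) [∀ a, IsMonHom (β a)]
    (hβ : ∀ a, β a ≫ j = j ≫ (act a).hom.hom.hom)
    (hβone : β 1 = 𝟙 G) (hβadd : ∀ a b, β (a + b) = β a * β b) (hβmul : ∀ a b, β (a * b) = β b ≫ β a)
    (hRos : ∀ a, (act (star a)).hom.hom.hom ≫ pol.lam =
      pol.lam ≫ dualIsogenyOver (A' := (AbelianScheme.ofAbelianVariety A).toOver) (B := (AbelianScheme.ofAbelianVariety A).toOver)
        (act a).hom.hom.hom D D)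
    -- the two-block ideal and the CRT elements
    (I : Ideal O) (hpI : (p : O) ∈ I) (hactp : (act (p : O)).hom.hom.hom = ((((p ^ 1 : ℕ) : ℤ) • 𝟙 A).hom.hom.hom))
    (ew ecw : O) (hsum : ew + ecw - 1 ∈ I) (hI : ∀ a ∈ I, ∃ c : O, a * (ew + ecw) = p • c)
    (hew : ∃ c : O, ew * ew = ew + p • c) (hecw : ∃ c : O, ecw * ecw = ecw + p • c)
    (hsq : ∃ c : O, (ew + ecw) * (ew + ecw) = (ew + ecw) + p • c)
    (hstar₁ : ∃ c : O, star ecw = ew + p • c) (hstar₂ : ∃ c : O, star (ew + ecw) = (ew + ecw) + p • c) :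
    ∃ (G' : SchemeOver k) (_ : GrpObj G') (_ : IsCommMonObj G') (_ : IsAffine G'.left) (_ : Module.Free k (Alg G')) (_ : Module.Finite k (Alg G'))
      (j' : G' ⟶ A.X) (_ : IsMonHom j') (_ : IsClosedImmersion j'.left)
      (e : G' ≅ cartierDual G') (_ : IsMonHom e.hom)
      (εW εV : G' ⟶ G') (_ : IsMonHom εW) (_ : IsMonHom εV),
      (∀ ⦃T : SchemeOver k⦄ (t : T ⟶ A.X), (∃ s : T ⟶ G', s ≫ j' = t) ↔ ∀ a ∈ I, t ≫ (act a).hom.hom.hom = 1) ∧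
      εW ≫ j' = j' ≫ (act ew).hom.hom.hom ∧ εV ≫ j' = j' ≫ (act ecw).hom.hom.hom ∧
      εW * εV = 𝟙 G' ∧ εV ≫ εV = εV ∧ εW ≫ εW = εW ∧
      εW ≫ e.hom = e.hom ≫ cartierDualMap εV ∧
      -- (ED. 3) the pairing-value clause: `⟪t ≫ e, s⟫ = e_p(s ≫ j′, (t ≫ j′) ≫ λ)` on finite points
      ∀ ⦃T : Type u⦄ [CommRing T] [Algebra k T] [Module.Finite k T] (t s : specOver k T ⟶ G')
        (ht : ((t ≫ j') ≫ pol.lam) ^ (p ^ 1) = 1) (hs : (s ≫ j') ^ (p ^ 1) = 1),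
        cartierPairing G' (t ≫ e.hom) s = D.weilChar hD (p ^ 1) ((t ≫ j') ≫ pol.lam) ht (s ≫ j') hs := by
  haveI : Mono j := Over.mono_of_mono_left j
  -- (0) the hermitian Weil duality `e₀ : G ≅ G^D` (★ (W-λ) H1 at `r = 1`) and `[p]_G = 1`
  obtain ⟨e₀, he₀mon, hherm, hpair₀⟩ := exists_hermitianDuality_of_polarization_pairing p 1 A D hD pol G j hG Ĝ ĵ hĜ hlam O star act β hβ hRos
  haveI := he₀mon
  obtain ⟨-, -, -, hN⟩ := exists_layerEnd_abelianVariety A (p ^ 1) G j hG act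
  rw [pow_one] at hN
  -- (1) the self-adjoint idempotent `ε := β (ew + ecw)` and its fixed layer `G′`
  obtain ⟨c₃, hc₃⟩ := hsq
  have hεε : β (ew + ecw) ≫ β (ew + ecw) = β (ew + ecw) := layerEnd_idem_of_mul_self_eq β hβadd hβmul hN hc₃
  have hεstar : β (star (ew + ecw)) = β (ew + ecw) := by
    obtain ⟨c, hc⟩ := hstar₂
    exact layerEnd_eq_of_eq_add_nsmul β hβadd hN hc
  have hadj₀ : β (ew + ecw) ≫ e₀.hom = e₀.hom ≫ cartierDualMap (β (ew + ecw)) := by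
    have h := hherm (ew + ecw)
    rw [hεstar] at h
    exact h
  obtain ⟨W, grpW, commW, affW, freeW, finW, jW, monW, ciW, hW⟩ := exists_fixedLayer G (β (ew + ecw))
  haveI : Mono jW := Over.mono_of_mono_left jW
  have hjWε : jW ≫ β (ew + ecw) = jW := (hW jW).1 ⟨𝟙 W, Category.id_comp jW⟩
  -- (2) the block duality `e : W ≅ W^D`
  obtain ⟨e, hemon, he⟩ := exists_blockDuality G e₀ (β (ew + ecw)) (β (ew + ecw)) hεε hεε hadj₀ W jW hW W jW hW
  -- (3) the two layer endomorphisms `εW`, `εV` of `W` (`β ew`, `β ecw` commute with `ε`)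
  have hcommW : β ew ≫ β (ew + ecw) = β (ew + ecw) ≫ β ew := by rw [← hβmul, ← hβmul, mul_comm]
  have hcommV : β ecw ≫ β (ew + ecw) = β (ew + ecw) ≫ β ecw := by rw [← hβmul, ← hβmul, mul_comm]
  obtain ⟨εW, hεW⟩ := (hW (jW ≫ β ew)).2 (by rw [Category.assoc, hcommW, ← Category.assoc, hjWε])
  obtain ⟨εV, hεV⟩ := (hW (jW ≫ β ecw)).2 (by rw [Category.assoc, hcommV, ← Category.assoc, hjWε])
  haveI : IsMonHom (εW ≫ jW) := by rw [hεW]; infer_instance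
  haveI : IsMonHom (εV ≫ jW) := by rw [hεV]; infer_instance
  haveI hεWmon : IsMonHom εW := isMonHom_of_comp jW εW
  haveI hεVmon : IsMonHom εV := isMonHom_of_comp jW εV
  refine ⟨W, grpW, commW, affW, freeW, finW, jW ≫ j, inferInstance, ?_, e, hemon, εW, εV, hεWmon, hεVmon, ?_, ?_, ?_, ?_, ?_, ?_, ?_, ?_⟩
  · rw [Over.comp_left]; infer_instance
  · -- POINTS: `G′` realises `A[I]`
    intro T t
    constructor
    · rintro ⟨s, rfl⟩ a ha
      obtain ⟨c, hc⟩ := hI a ha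
      have hkill : β (ew + ecw) ≫ β a = 1 := by
        rw [← hβmul, hc, layerEnd_nsmul β hβadd, ← Category.comp_id (β c), ← MonObj.comp_pow, hN, MonObj.comp_one]
      rw [Category.assoc, Category.assoc, ← hβ a, ← Category.assoc jW, ← hjWε, Category.assoc jW, hkill, MonObj.comp_one, MonObj.one_comp,
        MonObj.comp_one]
    · intro ht
      have htp : t ≫ ((((p ^ 1 : ℕ) : ℤ) • 𝟙 A).hom.hom.hom) = 1 := by rw [← hactp]; exact ht _ hpI
      obtain ⟨s₀, hs₀⟩ := (hG t).2 htp
      -- `s₀` is fixed by `ε`: `s₀ ≫ β(ew+ecw) = s₀ · (s₀ ≫ β m)`, `m = ew + ecw - 1 ∈ I` kills `t`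
      have hm : s₀ ≫ β (ew + ecw - 1) = 1 := by
        rw [← cancel_mono j, Category.assoc, hβ, ← Category.assoc, hs₀, ht _ hsum, MonObj.one_comp]
      have hfix : s₀ ≫ β (ew + ecw) = s₀ := by
        have : ew + ecw = 1 + (ew + ecw - 1) := by ring
        rw [this, hβadd, MonObj.comp_mul, hβone, Category.comp_id, hm, mul_one]
      obtain ⟨s, hs⟩ := (hW s₀).2 hfix
      exact ⟨s, by rw [← Category.assoc, hs, hs₀]⟩
  · rw [← Category.assoc, hεW, Category.assoc, hβ, Category.assoc]
  · rw [← Category.assoc, hεV, Category.assoc, hβ, Category.assoc]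
  · -- `εW * εV = 𝟙`
    rw [← cancel_mono jW, MonObj.mul_comp, hεW, hεV, ← MonObj.comp_mul, ← hβadd, hjWε, Category.id_comp]
  · -- `εV ≫ εV = εV`
    obtain ⟨c, hc⟩ := hecw
    rw [← cancel_mono jW, Category.assoc, hεV, ← Category.assoc, hεV, Category.assoc, layerEnd_idem_of_mul_self_eq β hβadd hβmul hN hc]
  · -- `εW ≫ εW = εW`
    obtain ⟨c, hc⟩ := hew
    rw [← cancel_mono jW, Category.assoc, hεW, ← Category.assoc, hεW, Category.assoc, layerEnd_idem_of_mul_self_eq β hβadd hβmul hN hc]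
  · -- the Rosati adjointness on the cut: `εW ≫ e = e ≫ εV^D`
    have hβstar : β (star ecw) = β ew := by
      obtain ⟨c, hc⟩ := hstar₁
      exact layerEnd_eq_of_eq_add_nsmul β hβadd hN hc
    rw [← he, ← Category.assoc, ← Category.assoc, hεW, Category.assoc jW, ← hβstar, hherm ecw, Category.assoc, Category.assoc, Category.assoc,
      ← cartierDualMap_comp, ← cartierDualMap_congr hεV, cartierDualMap_comp]
    simp only [Category.assoc]
  · -- (ED. 3) the pairing values of the cut: `t ≫ e = ((t ≫ jW) ≫ e₀) ≫ jW^D`, adjunction ★ `cartierPairing_comp_cartierDualMap`, then `e₀`'s clause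
    intro T _ _ _ t s ht hs
    have ht' : (((t ≫ jW) ≫ j) ≫ pol.lam) ^ (p ^ 1) = 1 := by rw [Category.assoc t jW j]; exact ht
    have hs' : ((s ≫ jW) ≫ j) ^ (p ^ 1) = 1 := by rw [Category.assoc s jW j]; exact hs
    rw [← he, ← Category.assoc, ← Category.assoc, cartierPairing_comp_cartierDualMap, hpair₀ (t ≫ jW) (s ≫ jW) ht' hs']
    exact D.weilChar_congr hD (p ^ 1) (by rw [Category.assoc t jW j]) _ ht (by rw [Category.assoc s jW j]) _ hs


end DualPair

/-! ## §0′ (ED. 4) The CRT elements WITH their block memberships `e_w ∈ 𝔭_{c•w}`, `e_{c•w} ∈ 𝔭_w` (organ (C6′)-fold (s-FIX) of line L2) -/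

set_option maxHeartbeats 400000 in
/-- **THE TWO CRT ELEMENTS `e_w, e_{c•w}` OF `𝓞 F` MODULO `p`, WITH THEIR BLOCK MEMBERSHIPS** (ED. 4 = ED. 2's `exists_blockIdempotents` + the two rows
`ew ∈ 𝔭_{c•w}`, `ecw ∈ 𝔭_w` that say WHICH block each idempotent cuts — needed by the (C6′) fold's (s-FIX) «the `ε_V = β(e_{c•w})`-fixed points of `A[𝔭_w𝔭_{c•w}]` are
`𝔭_{c•w}`-torsion, hence dock points»; the ED. 2 rows are symmetric under `ew ↔ ecw` and cannot tell): for a CM field `F`, a finite place `w` with `c•w ≠ w` over the rational prime `p`,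
UNRAMIFIED at `w` and at `c•w` (so `(p) = 𝔭_w 𝔭_{c•w} 𝔟` with pairwise comaximal factors), there are `ew ≡ (1,0,0)` and `ecw ≡ (0,1,0)` modulo
`𝔭_w × 𝔭_{c•w} × 𝔟` with exactly the congruences the head `exists_twoBlock_hermitianDuality` consumes (`I := 𝔭_w𝔭_{c•w}`, `star := (c • ·)`):
`ew + ecw - 1 ∈ I`, `I·(ew+ecw) ⊆ p•𝒪`, `ew² ≡ ew`, `ecw² ≡ ecw`, `(ew+ecw)² ≡ ew+ecw`, `c•ecw ≡ ew`, `c•(ew+ecw) ≡ ew+ecw` modulo `p`, and `p ∈ I`.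
[cite: Neukirch1999, Ch. I §3 (3.6)] [cite: Tate1967, §2.2] -/
theorem exists_blockIdempotents_mem {F : Type} [Field F] [NumberField F] [IsCMField F]
    (w : HeightOneSpectrum (𝓞 F)) (hw : (IsCMField.complexConj F) • w ≠ w)
    {p : ℕ} (hpw : (p : 𝓞 F) ∈ w.asIdeal)
    (hunr : ¬ w.asIdeal ^ 2 ∣ Ideal.span {(p : 𝓞 F)}) (hunr' : ¬ ((IsCMField.complexConj F) • w).asIdeal ^ 2 ∣ Ideal.span {(p : 𝓞 F)}) :
    ∃ ew ecw : 𝓞 F,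
      ew + ecw - 1 ∈ w.asIdeal * ((IsCMField.complexConj F) • w).asIdeal ∧
      (∀ a ∈ w.asIdeal * ((IsCMField.complexConj F) • w).asIdeal, ∃ c : 𝓞 F, a * (ew + ecw) = p • c) ∧
      (∃ c : 𝓞 F, ew * ew = ew + p • c) ∧ (∃ c : 𝓞 F, ecw * ecw = ecw + p • c) ∧
      (∃ c : 𝓞 F, (ew + ecw) * (ew + ecw) = (ew + ecw) + p • c) ∧
      (∃ c : 𝓞 F, (IsCMField.complexConj F) • ecw = ew + p • c) ∧
      (∃ c : 𝓞 F, (IsCMField.complexConj F) • (ew + ecw) = (ew + ecw) + p • c) ∧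
      (p : 𝓞 F) ∈ w.asIdeal * ((IsCMField.complexConj F) • w).asIdeal ∧
      -- (ED. 4) the BLOCK MEMBERSHIPS: `e_w ∈ 𝔭_{c•w}` (so `e_w ≡ 1 (𝔭_w)`), `e_{c•w} ∈ 𝔭_w` (so `e_{c•w} ≡ 1 (𝔭_{c•w})`)
      ew ∈ ((IsCMField.complexConj F) • w).asIdeal ∧ ecw ∈ w.asIdeal := by
  classical
  set cc := IsCMField.complexConj F with hccdef
  set 𝔭 : Ideal (𝓞 F) := w.asIdeal with h𝔭def
  set 𝔮 : Ideal (𝓞 F) := (cc • w).asIdeal with h𝔮def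
  have h𝔮𝔭 : 𝔮 = cc • 𝔭 := rfl
  have h𝔭𝔮ne : 𝔭 ≠ 𝔮 := fun h => hw (HeightOneSpectrum.ext h.symm)
  haveI : 𝔭.IsMaximal := w.isMaximal
  haveI : 𝔮.IsMaximal := (cc • w).isMaximal
  -- conjugation on elements
  have hccp : cc • ((p : 𝓞 F)) = (p : 𝓞 F) := by
    simpa only [MulSemiringAction.toRingHom_apply] using map_natCast (MulSemiringAction.toRingHom _ (𝓞 F) cc) p
  have hconj_coe : ∀ b : 𝓞 F, ((cc • b : 𝓞 F) : F) = cc (b : F) := fun _ => rfl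
  have hconj_conj : ∀ b : 𝓞 F, cc • (cc • b) = b := fun b => by
    apply RingOfIntegers.ext
    rw [hconj_coe, hconj_coe, hccdef, IsCMField.complexConj_apply_apply]
  have hmem𝔮 : ∀ b : 𝓞 F, cc • b ∈ 𝔮 ↔ b ∈ 𝔭 := fun b => by rw [h𝔮𝔭]; exact Ideal.smul_mem_pointwise_smul_iff
  have hmem𝔭 : ∀ b : 𝓞 F, cc • b ∈ 𝔭 ↔ b ∈ 𝔮 := fun b => by rw [← hmem𝔮, hconj_conj]
  have hp𝔮 : (p : 𝓞 F) ∈ 𝔮 := by rw [← hccp]; exact (hmem𝔮 _).2 hpw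
  -- `(p) = 𝔭 𝔮 𝔟`, pairwise comaximal
  obtain ⟨J₁, hJ₁⟩ := Ideal.dvd_span_singleton.mpr hpw
  have h𝔮dvdJ₁ : 𝔮 ∣ J₁ := by
    have h : 𝔮 ∣ 𝔭 * J₁ := hJ₁ ▸ Ideal.dvd_span_singleton.mpr hp𝔮
    rcases (Ideal.prime_of_isPrime (cc • w).ne_bot inferInstance).dvd_or_dvd h with h' | h'
    · exact absurd (Ideal.IsMaximal.eq_of_le inferInstance (Ideal.IsPrime.ne_top inferInstance) (Ideal.dvd_iff_le.mp h')) h𝔭𝔮ne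
    · exact h'
  obtain ⟨𝔟, h𝔟⟩ := h𝔮dvdJ₁
  have hfac : Ideal.span {(p : 𝓞 F)} = 𝔭 * 𝔮 * 𝔟 := by rw [hJ₁, h𝔟, mul_assoc]
  have h𝔭𝔟 : 𝔭 ⊔ 𝔟 = ⊤ := by
    by_contra hne
    have e : 𝔭 = 𝔭 ⊔ 𝔟 := Ideal.IsMaximal.eq_of_le inferInstance hne le_sup_left
    have h𝔟le : 𝔟 ≤ 𝔭 := calc 𝔟 ≤ 𝔭 ⊔ 𝔟 := le_sup_right
      _ = 𝔭 := e.symm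
    obtain ⟨𝔠, h𝔠⟩ := Ideal.dvd_iff_le.mpr h𝔟le
    exact hunr ⟨𝔮 * 𝔠, by rw [hfac, h𝔠]; ring⟩
  have h𝔮𝔟 : 𝔮 ⊔ 𝔟 = ⊤ := by
    by_contra hne
    have e : 𝔮 = 𝔮 ⊔ 𝔟 := Ideal.IsMaximal.eq_of_le inferInstance hne le_sup_left
    have h𝔟le : 𝔟 ≤ 𝔮 := calc 𝔟 ≤ 𝔮 ⊔ 𝔟 := le_sup_right
      _ = 𝔮 := e.symm
    obtain ⟨𝔠, h𝔠⟩ := Ideal.dvd_iff_le.mpr h𝔟le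
    exact hunr' ⟨𝔭 * 𝔠, by rw [hfac, h𝔠]; ring⟩
  have h𝔭𝔮 : 𝔭 ⊔ 𝔮 = ⊤ := Ideal.IsMaximal.coprime_of_ne inferInstance inferInstance h𝔭𝔮ne
  have h𝔭_𝔮𝔟 : 𝔭 ⊔ 𝔮 * 𝔟 = ⊤ := Ideal.isCoprime_iff_sup_eq.mp
    (IsCoprime.mul_right (Ideal.isCoprime_iff_sup_eq.mpr h𝔭𝔮) (Ideal.isCoprime_iff_sup_eq.mpr h𝔭𝔟))
  have h𝔮_𝔭𝔟 : 𝔮 ⊔ 𝔭 * 𝔟 = ⊤ := Ideal.isCoprime_iff_sup_eq.mp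
    (IsCoprime.mul_right (Ideal.isCoprime_iff_sup_eq.mpr ((sup_comm 𝔮 𝔭).trans h𝔭𝔮)) (Ideal.isCoprime_iff_sup_eq.mpr h𝔮𝔟))
  have h𝔭𝔮_𝔟 : 𝔭 * 𝔮 ⊔ 𝔟 = ⊤ := Ideal.isCoprime_iff_sup_eq.mp
    (IsCoprime.mul_left (Ideal.isCoprime_iff_sup_eq.mpr h𝔭𝔟) (Ideal.isCoprime_iff_sup_eq.mpr h𝔮𝔟))
  have hp𝔭𝔮 : (p : 𝓞 F) ∈ 𝔭 * 𝔮 := Ideal.dvd_span_singleton.mp ⟨𝔟, hfac⟩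
  -- `c • 𝔟 = 𝔟` (cancel `𝔭𝔮` in `c • (p) = (p)`)
  have hcc2 : cc * cc = 1 := AlgEquiv.ext fun x => by
    rw [AlgEquiv.mul_apply, AlgEquiv.one_apply, hccdef, IsCMField.complexConj_apply_apply]
  have hc𝔮 : cc • 𝔮 = 𝔭 := by rw [h𝔮𝔭, smul_smul, hcc2, one_smul]
  have hc𝔟 : cc • 𝔟 = 𝔟 := by
    have h1 : cc • Ideal.span {(p : 𝓞 F)} = Ideal.span {(p : 𝓞 F)} := by
      rw [Ideal.pointwise_smul_def, Ideal.map_span, Set.image_singleton, MulSemiringAction.toRingHom_apply, hccp]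
    rw [hfac, smul_mul', smul_mul', ← h𝔮𝔭, hc𝔮] at h1
    have h2 : (𝔭 * 𝔮) * (cc • 𝔟) = (𝔭 * 𝔮) * 𝔟 := by rw [← h1]; ring
    exact mul_left_cancel₀ (mul_ne_zero w.ne_bot (cc • w).ne_bot) h2
  -- `span {p} = 𝔭 ⊓ 𝔮 ⊓ 𝔟` and its elements are `p`-multiples
  have hinf : ∀ x : 𝓞 F, x ∈ 𝔭 → x ∈ 𝔮 → x ∈ 𝔟 → x ∈ Ideal.span {(p : 𝓞 F)} := fun x h1 h2 h3 => by
    rw [hfac, Ideal.mul_eq_inf_of_coprime h𝔭𝔮_𝔟, Ideal.mul_eq_inf_of_coprime h𝔭𝔮]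
    exact ⟨⟨h1, h2⟩, h3⟩
  have hspan_p : ∀ x ∈ Ideal.span {(p : 𝓞 F)}, ∃ c : 𝓞 F, x = p • c := fun x hx => by
    obtain ⟨a, ha⟩ := Ideal.mem_span_singleton'.mp hx
    exact ⟨a, by rw [nsmul_eq_mul, mul_comm, ha]⟩
  have hle₁ : 𝔮 * 𝔟 * 𝔭 ≤ Ideal.span {(p : 𝓞 F)} := by rw [hfac]; exact le_of_eq (by ring)
  have hle₂ : 𝔭 * 𝔟 * 𝔮 ≤ Ideal.span {(p : 𝓞 F)} := by rw [hfac]; exact le_of_eq (by ring)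
  have hle₃ : (𝔮 * 𝔟) * (𝔭 * 𝔟) ≤ Ideal.span {(p : 𝓞 F)} := by
    rw [hfac]
    calc (𝔮 * 𝔟) * (𝔭 * 𝔟) = (𝔭 * 𝔮 * 𝔟) * 𝔟 := by ring
      _ ≤ 𝔭 * 𝔮 * 𝔟 := Ideal.mul_le_right
  have hle₄ : (𝔭 * 𝔮) * (𝔮 * 𝔟) ≤ Ideal.span {(p : 𝓞 F)} := by
    rw [hfac]
    calc (𝔭 * 𝔮) * (𝔮 * 𝔟) = (𝔭 * 𝔮 * 𝔟) * 𝔮 := by ring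
      _ ≤ 𝔭 * 𝔮 * 𝔟 := Ideal.mul_le_right
  have hle₅ : (𝔭 * 𝔮) * (𝔭 * 𝔟) ≤ Ideal.span {(p : 𝓞 F)} := by
    rw [hfac]
    calc (𝔭 * 𝔮) * (𝔭 * 𝔟) = (𝔭 * 𝔮 * 𝔟) * 𝔭 := by ring
      _ ≤ 𝔭 * 𝔮 * 𝔟 := Ideal.mul_le_right
  -- THE ELEMENTS: `1 = a₁ + ew`, `a₁ ∈ 𝔭`, `ew ∈ 𝔮𝔟`; `1 = a₂ + ecw`, `a₂ ∈ 𝔮`, `ecw ∈ 𝔭𝔟`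
  obtain ⟨a₁, ha₁, ew, hew, h₁⟩ := Submodule.mem_sup.mp ((Ideal.eq_top_iff_one _).mp h𝔭_𝔮𝔟)
  obtain ⟨a₂, ha₂, ecw, hecw, h₂⟩ := Submodule.mem_sup.mp ((Ideal.eq_top_iff_one _).mp h𝔮_𝔭𝔟)
  have hew𝔮 : ew ∈ 𝔮 := Ideal.mul_le_right hew
  have hew𝔟 : ew ∈ 𝔟 := Ideal.mul_le_left hew
  have hecw𝔭 : ecw ∈ 𝔭 := Ideal.mul_le_right hecw
  have hecw𝔟 : ecw ∈ 𝔟 := Ideal.mul_le_left hecw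
  have hew1 : ew - 1 = -a₁ := by rw [← h₁]; ring
  have hecw1 : ecw - 1 = -a₂ := by rw [← h₂]; ring
  -- the squares
  have hsq₁ : ew * ew - ew ∈ Ideal.span {(p : 𝓞 F)} := by
    have : ew * ew - ew = ew * (ew - 1) := by ring
    rw [this, hew1, mul_neg]
    exact Submodule.neg_mem _ (hle₁ (Ideal.mul_mem_mul hew ha₁))
  have hsq₂ : ecw * ecw - ecw ∈ Ideal.span {(p : 𝓞 F)} := by
    have : ecw * ecw - ecw = ecw * (ecw - 1) := by ring
    rw [this, hecw1, mul_neg]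
    exact Submodule.neg_mem _ (hle₂ (Ideal.mul_mem_mul hecw ha₂))
  have hprod : ew * ecw ∈ Ideal.span {(p : 𝓞 F)} := hle₃ (Ideal.mul_mem_mul hew hecw)
  -- the conjugates: `c•ecw - ew`, `c•ew - ecw ∈ (p)`
  have hst₁ : cc • ecw - ew ∈ Ideal.span {(p : 𝓞 F)} := by
    have e : cc • ecw = 1 - cc • a₂ := by rw [eq_sub_iff_add_eq, ← smul_add, add_comm, h₂, smul_one]
    refine hinf _ ?_ ?_ ?_
    · rw [e, show (1 : 𝓞 F) - cc • a₂ - ew = a₁ - cc • a₂ by rw [← h₁]; ring]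
      exact Submodule.sub_mem _ ha₁ ((hmem𝔭 a₂).2 ha₂)
    · exact Submodule.sub_mem _ ((hmem𝔮 ecw).2 hecw𝔭) hew𝔮
    · exact Submodule.sub_mem _ (hc𝔟 ▸ Ideal.smul_mem_pointwise_smul_iff.2 hecw𝔟) hew𝔟
  have hst₂ : cc • ew - ecw ∈ Ideal.span {(p : 𝓞 F)} := by
    have e : cc • ew = 1 - cc • a₁ := by rw [eq_sub_iff_add_eq, ← smul_add, add_comm, h₁, smul_one]
    refine hinf _ ?_ ?_ ?_
    · exact Submodule.sub_mem _ ((hmem𝔭 ew).2 hew𝔮) hecw𝔭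
    · rw [e, show (1 : 𝓞 F) - cc • a₁ - ecw = a₂ - cc • a₁ by rw [← h₂]; ring]
      exact Submodule.sub_mem _ ha₂ ((hmem𝔮 a₁).2 ha₁)
    · exact Submodule.sub_mem _ (hc𝔟 ▸ Ideal.smul_mem_pointwise_smul_iff.2 hew𝔟) hecw𝔟
  refine ⟨ew, ecw, ?_, ?_, ?_, ?_, ?_, ?_, ?_, hp𝔭𝔮, hew𝔮, hecw𝔭⟩
  · -- `ew + ecw - 1 ∈ 𝔭𝔮 = 𝔭 ⊓ 𝔮`
    rw [Ideal.mul_eq_inf_of_coprime h𝔭𝔮]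
    refine ⟨?_, ?_⟩
    · rw [show ew + ecw - 1 = ecw - a₁ by rw [← h₁]; ring]; exact Submodule.sub_mem _ hecw𝔭 ha₁
    · rw [show ew + ecw - 1 = ew - a₂ by rw [← h₂]; ring]; exact Submodule.sub_mem _ hew𝔮 ha₂
  · -- `I·(ew + ecw) ⊆ (p)`
    intro a ha
    apply hspan_p
    rw [mul_add]
    exact Submodule.add_mem _ (hle₄ (Ideal.mul_mem_mul ha hew)) (hle₅ (Ideal.mul_mem_mul ha hecw))
  · obtain ⟨c, hc⟩ := hspan_p _ hsq₁
    exact ⟨c, by rw [← hc]; ring⟩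
  · obtain ⟨c, hc⟩ := hspan_p _ hsq₂
    exact ⟨c, by rw [← hc]; ring⟩
  · have h : (ew + ecw) * (ew + ecw) - (ew + ecw) ∈ Ideal.span {(p : 𝓞 F)} := by
      have : (ew + ecw) * (ew + ecw) - (ew + ecw) = (ew * ew - ew) + (ecw * ecw - ecw) + 2 * (ew * ecw) := by ring
      rw [this]
      exact Submodule.add_mem _ (Submodule.add_mem _ hsq₁ hsq₂) (Ideal.mul_mem_left _ _ hprod)
    obtain ⟨c, hc⟩ := hspan_p _ h
    exact ⟨c, by rw [← hc]; ring⟩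
  · obtain ⟨c, hc⟩ := hspan_p _ hst₁
    exact ⟨c, by rw [← hc]; ring⟩
  · have h : cc • (ew + ecw) - (ew + ecw) ∈ Ideal.span {(p : 𝓞 F)} := by
      have : cc • (ew + ecw) - (ew + ecw) = (cc • ew - ecw) + (cc • ecw - ew) := by rw [smul_add]; ring
      rw [this]
      exact Submodule.add_mem _ hst₂ hst₁
    obtain ⟨c, hc⟩ := hspan_p _ h
    exact ⟨c, by rw [← hc]; ring⟩

end AbelianSchemeOver

end Literature.AlgebraicGeometry.AbelianSchemes

end
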